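import Summits.HubbardSuperconductivity.HubbardSuperconductivity.Theorems.NodalWardXYVisonPairCostIRDefs
import Literature.Analysis.InnerProduct.SchurInequality
import Mathlib.Analysis.SpecialFunctions.Complex.LogBounds

/-!
# `TwoSidedLogDet` for the line `Sketch` of the crux `NodalWardXY.VisonPairCost`

(IR-1) of the infrared chain: for complex square matrices `X₁, X₂` and a resolvent bound
`‖v‖² ≤ K² ‖(1 + X₁X₂) v‖²` (`K ≥ 1`),

  `|log ‖det(1 + X₁X₂)‖| ≤ √(F₁F₂) + F₁F₂ (5 + 4 log K)`, `Fᵢ = Σ_{j,l} ‖(Xᵢ)_{jl}‖²`.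

Proof.  Let `y` run over the roots of the characteristic polynomial of `Y = X₁X₂` (with
multiplicity).  Then `det(1 + Y) = Π (1 + y)`, `tr Y = Σ y`, each `y` has an eigenvector `u`, so the
resolvent bound applied to `u` gives `|1 + y| ≥ 1/K`; Schur's inequality and Cauchy–Schwarz give
`Σ |y|² ≤ ‖Y‖_F² ≤ F₁F₂` and `|tr Y| ≤ √(F₁F₂)`
(`Literature/Analysis/InnerProduct/SchurInequality.lean`).  Writing
`log|1 + y| = Re y + φ(y)`, the pointwise estimate `|φ(y)| ≤ |y|² (5 + 4 log K)`
(`abs_log_norm_one_add_sub_re_le`: `|φ(y)| ≤ |y|²` for `|y| ≤ ½` from Mathlib's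
`Complex.norm_log_one_add_sub_self_le`, and `−log K − |y| ≤ φ(y) ≤ 2|y|` with `1 < 4|y|²` for the big
roots) sums to the claim.
-/

noncomputable section

-- tree namespace Summit.HubbardSuperconductivity.HubbardSuperconductivity (D-0017)
set_option linter.dupNamespace false

namespace Summit.HubbardSuperconductivity.HubbardSuperconductivity.Theorems.VisonPairCost

open Literature.Analysis.InnerProduct
open scoped Matrix ComplexOrder ComplexConjugate

/-- Pointwise root estimate: if `K ≥ 1` and `|1 + y| ≥ 1/K` then
`|log|1 + y| − Re y| ≤ |y|² (5 + 4 log K)` (`|y| ≤ ½`: `|log(1+y) − y| ≤ |y|²`; `|y| > ½`: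
`−log K − |y| ≤ log|1+y| − Re y ≤ 2|y| ≤ 4|y|²` and `log K ≤ 4|y|² log K`). -/
theorem abs_log_norm_one_add_sub_re_le {y : ℂ} {K : ℝ} (hK : 1 ≤ K) (hy : K⁻¹ ≤ ‖1 + y‖) :
    |Real.log ‖1 + y‖ - y.re| ≤ ‖y‖ ^ 2 * (5 + 4 * Real.log K) := by
  have hlogK : 0 ≤ Real.log K := Real.log_nonneg hK
  have hKpos : 0 < K := by linarith
  have h1y : 0 < ‖1 + y‖ := (inv_pos.mpr hKpos).trans_le hy
  rcases le_or_gt ‖y‖ (1 / 2) with hs | hb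
  · -- small root
    have hlt : ‖y‖ < 1 := by linarith
    have h2 : ‖Complex.log (1 + y) - y‖ ≤ ‖y‖ ^ 2 := by
      refine (Complex.norm_log_one_add_sub_self_le hlt).trans ?_
      have hinv : (1 - ‖y‖)⁻¹ ≤ 2 := by
        rw [inv_le_comm₀ (by linarith) two_pos]; linarith
      calc ‖y‖ ^ 2 * (1 - ‖y‖)⁻¹ / 2 ≤ ‖y‖ ^ 2 * 2 / 2 := by gcongr
        _ = ‖y‖ ^ 2 := by ring
    have h3 : Real.log ‖1 + y‖ - y.re = (Complex.log (1 + y) - y).re := by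
      rw [Complex.sub_re, Complex.log_re]
    rw [h3]
    calc |(Complex.log (1 + y) - y).re| ≤ ‖Complex.log (1 + y) - y‖ := Complex.abs_re_le_norm _
      _ ≤ ‖y‖ ^ 2 := h2
      _ = ‖y‖ ^ 2 * 1 := (mul_one _).symm
      _ ≤ ‖y‖ ^ 2 * (5 + 4 * Real.log K) := by gcongr; linarith
  · -- big root
    have hlow : -Real.log K ≤ Real.log ‖1 + y‖ := by
      rw [← Real.log_inv]
      exact Real.log_le_log (inv_pos.mpr hKpos) hy
    have hup : Real.log ‖1 + y‖ ≤ ‖y‖ := by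
      have h1 : ‖1 + y‖ ≤ 1 + ‖y‖ := (norm_add_le _ _).trans (by simp)
      have h2 := Real.log_le_sub_one_of_pos h1y
      linarith
    have hre := abs_le.mp (Complex.abs_re_le_norm y)
    have ht2 : ‖y‖ ≤ 4 * ‖y‖ ^ 2 := by nlinarith
    have htL : Real.log K ≤ 4 * ‖y‖ ^ 2 * Real.log K := by
      have h4 : (0 : ℝ) ≤ 4 * ‖y‖ ^ 2 - 1 := by nlinarith
      nlinarith [mul_nonneg h4 hlogK]
    have hsq : 0 ≤ ‖y‖ ^ 2 * Real.log K := mul_nonneg (sq_nonneg _) hlogK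
    rw [abs_le]
    constructor
    · nlinarith [hlow, hre.2, ht2, htL, sq_nonneg ‖y‖]
    · nlinarith [hup, hre.1, ht2, hsq, sq_nonneg ‖y‖]

/-- **(IR-1) Two-sided log-determinant bound** (registered stub `stub_twoSidedLogDet` of the line
`Sketch`): `|log ‖det(1 + X₁X₂)‖| ≤ √(F₁F₂) + F₁F₂ (5 + 4 log K)` from the resolvent bound
`‖v‖² ≤ K² ‖(1 + X₁X₂)v‖²`, `K ≥ 1`, `Fᵢ = Σ ‖Xᵢ j l‖²` (Schur's inequality + root counting). -/
theorem stub_twoSidedLogDet : TwoSidedLogDet := by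
  intro n _ _ X₁ X₂ K hK hres
  classical
  have hKpos : 0 < K := by linarith
  have hlogK : 0 ≤ Real.log K := Real.log_nonneg hK
  set Y : Matrix n n ℂ := X₁ * X₂ with hY_def
  set F₁ : ℝ := ∑ i, ∑ j, ‖X₁ i j‖ ^ 2 with hF₁_def
  set F₂ : ℝ := ∑ i, ∑ j, ‖X₂ i j‖ ^ 2 with hF₂_def
  set s : Multiset ℂ := Y.charpoly.roots with hs_def
  -- multiset sums over the roots as sums over the finite type `s`
  have e_sum : ∀ g : ℂ → ℝ, (s.map g).sum = ∑ x : s, g x := fun g => by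
    rw [Finset.sum_eq_multiset_sum, Multiset.map_univ]
  have e_prod : ∀ g : ℂ → ℂ, (s.map g).prod = ∏ x : s, g x := fun g => by
    rw [Finset.prod_eq_multiset_prod, Multiset.map_univ]
  -- (1) spectral facts: `det(1+Y) = Π(1+y)`, `tr Y = Σ y`, Schur + Cauchy–Schwarz
  have hdet : (1 + Y).det = ∏ x : s, (1 + (x : ℂ)) := by
    rw [matrix_det_one_add_eq_prod_roots_charpoly, ← e_prod]
  have htr : Y.trace = ∑ x : s, (x : ℂ) := by
    rw [Matrix.trace_eq_sum_roots_charpoly, Multiset.sum_eq_sum_coe]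
  have hschur : ∑ x : s, ‖(x : ℂ)‖ ^ 2 ≤ F₁ * F₂ := by
    have h := (matrix_sum_norm_sq_roots_charpoly_le Y).trans (matrix_sum_norm_sq_mul_le X₁ X₂)
    rw [e_sum] at h
    exact h
  have htrle : ‖Y.trace‖ ≤ Real.sqrt (F₁ * F₂) := matrix_norm_trace_mul_le X₁ X₂
  -- (2) the resolvent bound on eigenvectors: `K⁻¹ ≤ ‖1 + y‖`
  have hroot : ∀ x : s, K⁻¹ ≤ ‖1 + (x : ℂ)‖ := by
    intro x
    have hx : (x : ℂ) ∈ s := Multiset.coe_mem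
    have hy' : Y.charpoly.IsRoot x := (Polynomial.mem_roots Y.charpoly_monic.ne_zero).mp hx
    obtain ⟨u, hu, hYu⟩ := matrix_exists_mulVec_eq_smul_of_isRoot_charpoly Y hy'
    have h1 : (1 + Y) *ᵥ u = (1 + (x : ℂ)) • u := by
      rw [Matrix.add_mulVec, Matrix.one_mulVec, hYu, add_smul, one_smul]
    have h2 := hres u
    rw [h1, star_smul, smul_dotProduct, dotProduct_smul, smul_smul,
      Complex.star_def, Complex.conj_mul', smul_eq_mul, ← Complex.ofReal_pow,
      Complex.re_ofReal_mul] at h2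
    -- `h2 : r ≤ K ^ 2 * (‖1 + x‖ ^ 2 * r)` with `r = (star u ⬝ᵥ u).re > 0`
    have hr : 0 < (star u ⬝ᵥ u).re :=
      (Complex.pos_iff.mp (Matrix.dotProduct_star_self_pos_iff.mpr hu)).1
    refine le_of_not_gt fun hlt => ?_
    have hprod : ‖1 + (x : ℂ)‖ * K < 1 := by
      have h := mul_lt_mul_of_pos_right hlt hKpos
      rwa [inv_mul_cancel₀ hKpos.ne'] at h
    have hsq : (‖1 + (x : ℂ)‖ * K) ^ 2 < 1 :=
      pow_lt_one₀ (mul_nonneg (norm_nonneg _) hKpos.le) hprod two_ne_zero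
    have h3 := mul_lt_mul_of_pos_right hsq hr
    nlinarith [h2, h3]
  -- (3) `log ‖det(1+Y)‖ = Σ log‖1+y‖ = Re tr Y + Σ φ(y)`
  have hne : ∀ x : s, ‖1 + (x : ℂ)‖ ≠ 0 := fun x =>
    ((inv_pos.mpr hKpos).trans_le (hroot x)).ne'
  have hlog : Real.log ‖(1 + Y).det‖ = ∑ x : s, Real.log ‖1 + (x : ℂ)‖ := by
    rw [hdet, norm_prod, Real.log_prod fun x _ => hne x]
  have hsplit : ∑ x : s, Real.log ‖1 + (x : ℂ)‖ =
      (Y.trace).re + ∑ x : s, (Real.log ‖1 + (x : ℂ)‖ - (x : ℂ).re) := by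
    rw [htr, Complex.re_sum, ← Finset.sum_add_distrib]
    exact Finset.sum_congr rfl fun x _ => by ring
  rw [hlog, hsplit]
  -- (4) pointwise estimate and summation
  have hφ : ∀ x : s, |Real.log ‖1 + (x : ℂ)‖ - (x : ℂ).re| ≤
      ‖(x : ℂ)‖ ^ 2 * (5 + 4 * Real.log K) :=
    fun x => abs_log_norm_one_add_sub_re_le hK (hroot x)
  calc |(Y.trace).re + ∑ x : s, (Real.log ‖1 + (x : ℂ)‖ - (x : ℂ).re)|
      ≤ |(Y.trace).re| + |∑ x : s, (Real.log ‖1 + (x : ℂ)‖ - (x : ℂ).re)| := abs_add_le _ _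
    _ ≤ ‖Y.trace‖ + ∑ x : s, |Real.log ‖1 + (x : ℂ)‖ - (x : ℂ).re| :=
        add_le_add (Complex.abs_re_le_norm _) (Finset.abs_sum_le_sum_abs _ _)
    _ ≤ Real.sqrt (F₁ * F₂) + ∑ x : s, ‖(x : ℂ)‖ ^ 2 * (5 + 4 * Real.log K) :=
        add_le_add htrle (Finset.sum_le_sum fun x _ => hφ x)
    _ = Real.sqrt (F₁ * F₂) + (∑ x : s, ‖(x : ℂ)‖ ^ 2) * (5 + 4 * Real.log K) := by
        rw [← Finset.sum_mul]
    _ ≤ Real.sqrt (F₁ * F₂) + F₁ * F₂ * (5 + 4 * Real.log K) := by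
        have h5 : (0 : ℝ) ≤ 5 + 4 * Real.log K := by linarith
        exact add_le_add le_rfl (mul_le_mul_of_nonneg_right hschur h5)

end Summit.HubbardSuperconductivity.HubbardSuperconductivity.Theorems.VisonPairCost
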